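import Mathlib
import Literature.RingTheory.TwoVariableSeries.Basic
import Summits.ResolutionOfSingularities.ResolutionOfSingularities.Theorems.WeightedInvariantLocalWeightedDropMonicDescentSliceIdentify
import Summits.ResolutionOfSingularities.ResolutionOfSingularities.Theorems.WeightedInvariantLocalWeightedDropMonicDescentVertexPersistence

/-!
# `WeightedInvariant.LocalWeightedDrop`, sub-stub N4″: small tools for the game bridge (piece T-6′)

Crux item stmt-ResolutionOfSingularities-8899 `LocalWeightedDrop` (route `ResolutionOfSingularities/WeightedInvariant`), door
`WeightedConstruction` stmt-ResolutionOfSingularities-0571.  [OURS · L1 W4.3, chain w43, lead prover; tools for the assembly of piece T-6′ (`monicDescentBridge`) of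
`N4PRIME-PLAN.md` §11.]

* `coeff_single_eq_zero_of_isPrepRecentring` — a well-preparing re-centring `ψ` of a POSITION has no linear terms (char 2: `(ψ²)_{2eᵢ} = ψ_{eᵢ}²` and the
  re-centred label is again a position); hence `constantCoeff (blowOne 1 ψ) = 0` (`constantCoeff_blowOne_one_eq`), so the transported re-centring of the
  `u₁`-chart is a genuine re-centring;
* `X_pow_mul_divTwo` — `u₂^c · divTwo c A = A` when `u₂^c ∣ A`;
* `represents_shear` — `pos B` is represented by every sheared label `shearLabel h B` (the shear `u₂ ↦ u₂ + u₁h` is a formal coordinate change with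
  unipotent linear part).
-/

set_option linter.dupNamespace false -- mandated namespace of this single-conjunct summit

noncomputable section

namespace Summit.ResolutionOfSingularities.ResolutionOfSingularities.Theorems

namespace MonicDescent

open MvPowerSeries Literature.RingTheory.TwoVariableSeries Literature.AlgebraicGeometry.Resolution

variable {k : Type} [Field k]

/-! ## Re-centrings of positions have order ≥ 2 -/

/-- A well-preparing re-centring of a position has no linear terms (char 2). -/
theorem coeff_single_eq_zero_of_isPrepRecentring [CharP k 2] {S₀ S₁ ψ : MvPowerSeries (Fin 2) k} (hS : IsPosition S₀ S₁)
    (hprep : IsPrepRecentring S₀ S₁ ψ) (i : Fin 2) : coeff (Finsupp.single i 1) ψ = 0 := by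
  obtain ⟨hψ0, hpos, -, -⟩ := hprep
  have hdeg1 : ∀ d : Fin 2 →₀ ℕ, Finsupp.degree d = d 0 + d 1 := by
    intro d; rw [Finsupp.degree_eq_sum]; simp [Fin.sum_univ_two]
  -- the coefficient of `u^{2eᵢ}` of the re-centred first component vanishes (order > 2)
  have hsum2 : (2 • Finsupp.single i 1 : Fin 2 →₀ ℕ) 0 + (2 • Finsupp.single i 1 : Fin 2 →₀ ℕ) 1 = 2 := by
    have : i = 0 ∨ i = 1 := by fin_cases i <;> simp
    rcases this with rfl | rfl <;> simp
  have hdeg2 : ((Finsupp.degree (2 • Finsupp.single i 1 : Fin 2 →₀ ℕ) : ℕ) : ℕ∞) = 2 := by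
    rw [hdeg1, hsum2]; rfl
  have h2 : coeff (2 • Finsupp.single i 1) (S₀ + S₁ * ψ + ψ ^ 2) = 0 := by
    apply coeff_of_lt_order
    rw [hdeg2]; exact hpos.1
  have hS0 : coeff (2 • Finsupp.single i 1) S₀ = 0 := by
    apply coeff_of_lt_order
    rw [hdeg2]; exact hS.1
  -- `S₁ψ` has order ≥ 3
  have hS1ψ : coeff (2 • Finsupp.single i 1) (S₁ * ψ) = 0 := by
    apply coeff_of_lt_order
    have hψ1 : (1 : ℕ∞) ≤ ψ.order := by
      apply MvPowerSeries.le_order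
      intro d hd
      have : d = 0 := by
        have h := Nat.cast_lt.mp hd
        rw [hdeg1] at h
        refine finsupp_fin2_ext ?_ ?_ <;> simp <;> omega
      rw [this]; exact hψ0
    refine lt_of_lt_of_le ?_ MvPowerSeries.le_order_mul
    have h2le : (2 : ℕ∞) ≤ S₁.order := by
      have := Order.add_one_le_of_lt hS.2
      norm_num at this
      exact this
    have h3 : (3 : ℕ∞) ≤ S₁.order + ψ.order := by
      have := add_le_add h2le hψ1
      norm_num at this
      exact this
    rw [hdeg2]
    exact lt_of_lt_of_le (by norm_num) h3
  rw [map_add, map_add, hS0, hS1ψ, zero_add, zero_add, coeff_two_smul_sq] at h2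
  exact pow_eq_zero_iff (n := 2) (by norm_num) |>.mp h2

/-- Hence the transported re-centring `blowOne 1 ψ` of the `u₁`-chart has zero constant term. -/
theorem constantCoeff_blowOne_one_eq (ψ : MvPowerSeries (Fin 2) k) :
    constantCoeff (blowOne 1 ψ) = coeff (Finsupp.single 0 1) ψ := by
  rw [← coeff_zero_eq_constantCoeff_apply, coeff_blowOne, if_pos (by simp)]
  have hidx : (Finsupp.single 0 ((0 : Fin 2 →₀ ℕ) 0 + 1 - (0 : Fin 2 →₀ ℕ) 1) + Finsupp.single 1 ((0 : Fin 2 →₀ ℕ) 1) : Fin 2 →₀ ℕ) =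
      Finsupp.single 0 1 := by
    refine finsupp_fin2_ext ?_ ?_ <;> simp
  rw [hidx]

/-! ## `divTwo` as a division -/

/-- `u₂^c · divTwo c A = A` when every exponent of `A` has `e₁ ≥ c`. -/
theorem X_pow_mul_divTwo (c : ℕ) (A : MvPowerSeries (Fin 2) k) (hA : ∀ e : Fin 2 →₀ ℕ, coeff e A ≠ 0 → c ≤ e 1) :
    X 1 ^ c * divTwo c A = A := by
  ext d
  rw [X_pow_eq, coeff_monomial_mul]
  by_cases hc : Finsupp.single 1 c ≤ d
  · rw [if_pos hc, one_mul, coeff_divTwo]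
    have hidx : (d - Finsupp.single 1 c : Fin 2 →₀ ℕ) + Finsupp.single 1 c = d := by
      refine finsupp_fin2_ext ?_ ?_
      · simp only [Finsupp.add_apply, Finsupp.single_apply, Finsupp.tsub_apply]; simp
      · have : c ≤ d 1 := by simpa using hc 1
        simp only [Finsupp.add_apply, Finsupp.single_apply, Finsupp.tsub_apply]; simp; omega
    rw [hidx]
  · rw [if_neg hc]
    symm
    by_contra hne
    have := hA d hne
    exact hc (by intro i; fin_cases i <;> simp [this])

/-! ## The shear is a formal coordinate change -/

/-- The game-variable version of the shear `u₂ ↦ u₂ + u₁ h` (identity on `s = u₁` and on `z`). -/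
def shear3 (h : MvPowerSeries (Fin 2) k) : Fin 3 → MvPowerSeries (Fin 3) k :=
  ![X 0, X 1 + X 0 * rename (Fin.succAboveEmb (Fin.last 2)) h, X 2]

/-- `shear3` has zero constant terms. -/
theorem constantCoeff_shear3 (h : MvPowerSeries (Fin 2) k) : ∀ i, constantCoeff (shear3 h i) = 0 := by
  intro i; fin_cases i <;> simp [shear3, constantCoeff_X]

/-- The linear part of `shear3` is unipotent lower-triangular. -/
theorem det_linMat_shear3 (h : MvPowerSeries (Fin 2) k) : (FormalCoordChange.linMat (shear3 h)).det = 1 := by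
  have hX0h : ∀ j : Fin 3, coeff (Finsupp.single j 1) (X 0 * rename (Fin.succAbove (2 : Fin 3)) h : MvPowerSeries (Fin 3) k) =
      if j = 0 then constantCoeff h else 0 := by
    intro j
    rw [show (X 0 : MvPowerSeries (Fin 3) k) = monomial (Finsupp.single 0 1) 1 from X_def 0, coeff_monomial_mul]
    by_cases hj : j = 0
    · subst hj
      rw [if_pos le_rfl, if_pos rfl, one_mul, tsub_self, coeff_zero_eq_constantCoeff_apply, constantCoeff_rename]
    · rw [if_neg, if_neg hj]
      intro hle
      have := hle 0
      simp [Ne.symm hj] at this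
  have hentry : ∀ i j : Fin 3, FormalCoordChange.linMat (shear3 h) i j =
      if i = j then 1 else if i = 1 ∧ j = 0 then constantCoeff h else 0 := by
    intro i j
    rw [FormalCoordChange.linMat, Matrix.of_apply]
    fin_cases i <;> fin_cases j <;> simp [shear3, coeff_index_single_X, hX0h]
  rw [Matrix.det_fin_three]
  simp only [hentry]
  simp

/-- Substituting `shear3 h` into a series of the base variables is the base shear. -/
theorem subst_shear3_rename (h B : MvPowerSeries (Fin 2) k) :
    subst (shear3 h) (rename (Fin.succAboveEmb (Fin.last 2)) B) = rename (Fin.succAboveEmb (Fin.last 2)) (shear h B) := by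
  have h3 := constantCoeff_shear3 h
  rw [subst_rename_eq _ _ h3, shear_eq, rename_subst_eq _ _ (constantCoeff_shearFamily h)]
  congr 1
  funext i
  have h0 : (Fin.succAboveEmb (Fin.last 2)) (0 : Fin 2) = (0 : Fin 3) := rfl
  have h1 : (Fin.succAboveEmb (Fin.last 2)) (1 : Fin 2) = (1 : Fin 3) := rfl
  fin_cases i
  · show shear3 h ((Fin.succAboveEmb (Fin.last 2)) 0) = rename _ (X 0)
    rw [h0, rename_X, h0]; rfl
  · show shear3 h ((Fin.succAboveEmb (Fin.last 2)) 1) = rename _ (X 1 + X 0 * h)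
    rw [h1, map_add, map_mul, rename_X, rename_X, h0, h1]; rfl

/-- THE SHEARED LABEL REPRESENTS THE SAME GERM: `Represents (pos B₀ B₁) (shear h B₀) (shear h B₁)`. -/
theorem represents_shear (h B₀ B₁ : MvPowerSeries (Fin 2) k) : Represents (pos B₀ B₁) (shear h B₀) (shear h B₁) := by
  have h3 := constantCoeff_shear3 h
  have h3s : HasSubst (shear3 h) := hasSubst_of_constantCoeff_zero h3
  refine ⟨shear3 h, 1, h3, ?_, one_ne_zero, ?_⟩
  · rw [det_linMat_shear3]; exact isUnit_one
  · unfold pos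
    have hz : shear3 h (Fin.last 2) = X (Fin.last 2) := rfl
    rw [one_mul, ← coe_substAlgHom h3s]
    simp only [map_add, map_mul, map_pow]
    rw [coe_substAlgHom, subst_X h3s, hz, subst_shear3_rename, subst_shear3_rename]

end MonicDescent

end Summit.ResolutionOfSingularities.ResolutionOfSingularities.Theorems

end
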